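/-
Copyright (c) 2026 the pub-hodgecm-mathlib formalisation cell (harness21).  Prover seat hodgecm-mathlib-K2E4-p14 (g10), Track B ∕ K2-LIT, h413 =
`stmt-HodgeConjecture-24833`, ENGINE E1, 5Res campaign «ENDGAME BY FAMILIES», RUNG 1, deal (273)(iii) of K2E1-plan (g7): the OFF-DUAL per-block package of
★ p860902 `residual_invariants_finiteDimensional_letterFree_of_blocks` §3 — FILE 1b, the model half (family, block identification, (y2) intertwining, model line).
-/
import Summits.HodgeConjecture.HodgeConjecture.Theorems.K2E1ResidualBlockPackageOffDualHeckeCMTwo          -- ★ FILE 1a (this seat): the off-dual Hecke operator on `V_P`, bricks fixed by `P_1`, projector algebra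
import Summits.HodgeConjecture.HodgeConjecture.Theorems.K2E1ChiSectionPlancherelGramDischargeCMTwo        -- ★ p860754 (K2E3-p12): `exists_repr_and_linearIsometry_chiSection_offDual_letterFree_cm_two`
import Summits.HodgeConjecture.HodgeConjecture.Theorems.K2E1ChiSectionHeckeIntertwiningGlobalCMTwo        -- ★ (y2) (K2E1-p11): `hU_offDual_global_cm_two` (+ ★ B2 `hU_offDual_cm_two`, ★ p860498 modelMap)
import Summits.HodgeConjecture.HodgeConjecture.Theorems.K2E1PseudoEisensteinSmoothBricksDenseU2            -- ★ p860789 (K2E1-p15): `topologicalClosure_span_continuous_eq_smooth` (hBD)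
import Summits.HodgeConjecture.HodgeConjecture.Theorems.K2E1ChiSectionBoundedOfUnitaryU2                 -- ★ p860823 (K2E1-p15): `exists_bound_of_isChiSection_of_isUnitary`
import Summits.HodgeConjecture.HodgeConjecture.Theorems.K2E1EisensteinNiceClassCMTwo                      -- ★ F3d-δ (K2E1-p15): `memLp_quotFun_eisensteinSeriesU_of_nice`
import Summits.HodgeConjecture.HodgeConjecture.Theorems.K2E1SymbolLineNoMassCMTwo                         -- ★ p860608 (K2-defs1): `hline_of_map_absolutelyContinuous`
import Summits.HodgeConjecture.HodgeConjecture.Theorems.K2E1SphericalEisensteinStructuralDataCMTwo       -- ★ (K2E1-p12): `exists_unipotent_haar_fundamentalDomain_cm_two`, `isInvInvariant_of_isHaarMeasure_cm_two`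
import Literature.NumberTheory.Automorphic.IdeleClassIntegration                                         -- ★ `exists_isIdeleClassDomain`
import HarnessLib

/-!
# K2·E1 — `K2E1ResidualBlockPackageOffDualFamilyCMTwo`: THE OFF-DUAL FAMILY, ITS BLOCK AND ITS MODEL INTERTWINING (FILE 1b of the off-dual block package, RUNG 1)

Track B ∕ K2-LIT, crux h413 = `stmt-HodgeConjecture-24833`, route of record `HCCMUnconditional`; cell `hodgecm-mathlib`, squad K2, ENGINE E1.  Prover seat `hodgecm-mathlib-K2E4-p14` (g10);
deal (273)(iii) of K2E1-plan (g7), rulings (274)(ii) (hBD payer ★ p860789), (278)–(279) (R2: off-dual blocks carry NO atoms, `A_b := PUnit`; R3: level currency, non-vacuity witness in-file).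
THEOREMS ONLY (no `def`, no `instance`, no notation, no named-fact hypothesis, no `sorry`); lane `--supports stmt-HodgeConjecture-24833 --as helper` (count-neutral).  CLOSES NO SOCKET.
Frame: `G = U(J₂) = quasiSplit L⁺ L c 2` (`= cmDatum L 2 J₂` rfl), `K_∞ = G(L⁺ ⊗ ℝ) ∩ U(1 ⊗ 1)`, `K = K_∞·GL₂(𝒪̂_L) = comap adelicVal K_GL`.

THE MATHEMATICS ([MoeglinWaldspurger1995, II.2.4, IV.3.12, VI.2]; [ReedSimonI1980, Thm. I.7, II.3]).  ★ p860902 reduces RUNG 1 («`(L²_res)^{K_∞·K′_f}` is finite-dimensional») to per-block data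
`(gen, A, Ω, m, E, V, hV, Jb, h, hhl, hhr, s, hs, hU, hline)`.  For an OFF-DUAL unitary Hecke character `χ` (`χ(χʷ)⁻¹` not a norm twist — after (278)(B) these are ALL but finitely many blocks,
of every archimedean type) this file delivers that data with NO atoms: the off-dual family `Θ_χ` (closed span of the bricks `[θ_{f,φ}]`, `φ ∈ V(χ, K_c, 1)`) is ISOMETRIC to `L²(ℝ × K_U)`
(★ p860754, letter-free), so `V := (0, U_iso ∘ P_Θ)` into `PUnit × L²(ℝ × K_U)` is injective on the block (`hV`); the Hecke operator is FILE 1a's `T = R_∞(a♮) ∘L R_f(e)` (gauge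
self-convolution `η` → ★ FILE 0 pure-tensor bridge → spherical compression), which on `V_P` is `P_1 ∘ R(η)`; ★ (y2) gives `U R(η) = σ • U` on ALL of `L²` (`σ = s(½+iy)`, `s` entire and
non-constant), FILE 1a §1∕§3 give `P_G P_1 = P_G` and `U_iso P_Θ P_G = U_iso P_Θ`, whence `hU` in p860902's bytes on `V_P`; `hline` is ★ p860608 on the axis coordinate (`(volume ⊗ μ_K) ∘ fst⁻¹
≪ volume`); the block identification `closure span gen = Θ_χ` is §1 (★ p860789: C⁰- and C^∞-profile bricks have the same closed span; C^∞ ⊆ C² ⊆ C⁰).  The degenerate block (no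
continuous non-zero section) is `⊥` and is served by a bounded entire non-constant symbol (§3).
* §0 `snd_prod_comp_eq_smul`, `snd_prod_comp_eq_smul_of_zero` (two lines of linear algebra).  * §1 `mem_bricks_of_ae_eq`, `eq_zero_of_isChiSection_of_forall_K`,
  `toLp_brick_eq_zero_of_section_eq_zero`, **`topologicalClosure_span_bricks_eq`**.  * §2 `integratedOperator_mem_closure_span_offDual`, **`exists_modelMap_intertwining`** (★ (y2) with
  `hadjΘ` discharged).  * §3 `map_fst_prod_absolutelyContinuous`, **`hline_model`**, `exists_bounded_entire_nonconstant`.  (The HEAD `offDual_block_package` and the M1 witness are FILE 1c `K2E1ResidualBlockPackageOffDualM1CMTwo`.)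
BINDERS LEFT VISIBLE (all structural, none asks an adelic subgroup to be open; §5 instantiates them at M1): the measures `νinf νf μK μKU`, the level `(K′_f, e, U₀, K_c)` with
`hK'o he0 he1 heK hK'U₀ hKcK hKinfKc hU₀Kc`, the block projector `P` (`hPdef`), `hVc` (continuity of the sections of `V(χ, K_c, 1)` — the standing letter of the level files), `χ` unitary
and off-dual, and `gen` with `hgen : closure span gen = closure span {C⁰-bricks}` (the C7″ generator bytes plug by a set extensionality).
HONEST LABEL: HC_CM is proved only modulo the 7 printed citations (2 remaining named inputs: hLiu418 = `stmt-HodgeConjecture-24832`, h413 = `stmt-HodgeConjecture-24833`) until rung 0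
closes; this file asserts no named fact and closes no socket; count-neutral; RUNG 1 (mod the SD package + FINAL of K2E4-p23) ≠ 5Res.

## References
* [MoeglinWaldspurger1995] C. Mœglin, J.-L. Waldspurger, *Spectral decomposition and Eisenstein series* (1995), II.1.2, II.2.4, IV.3.12, VI.2.
* [ReedSimonI1980] M. Reed, B. Simon, *Methods of Modern Mathematical Physics I* (1980), Thm. I.7, Thm. II.3, §VII.2.
* [Bump1997] D. Bump, *Automorphic Forms and Representations* (1997), proof of Lemma 2.3.2.
* [Gelbart1975] S. Gelbart, *Automorphic Forms on Adele Groups* (1975), (10.12)–(10.13).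
* [Folland1999] G. B. Folland, *Real Analysis* (1999), Prop. 8.17.
* [BorelJacquet1979] A. Borel, H. Jacquet, PSPM 33.1 (1979), §4.1, §4.6.
-/

set_option autoImplicit false
-- the mandated namespace repeats the single-problem summit's segment (`HodgeConjecture.HodgeConjecture`)
set_option linter.dupNamespace false

noncomputable section

open MeasureTheory MeasureTheory.Measure Filter Topology CompactlySupported NumberField NumberField.mixedEmbedding NumberField.InfinitePlace IsDedekindDomain Set Complex
open scoped ENNReal NNReal ComplexConjugate InnerProductSpace Real
open Literature.NumberTheory Literature.NumberTheory.Automorphic Literature.NumberTheory.Automorphic.UnitaryGroup AdelicGroupData ContRepresentation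
open Literature.NumberTheory.GaloisRepresentations (HeckeCharacter)
open Summit.HodgeConjecture.HodgeConjecture.Cruxes.H413.K2E1BorelEisensteinU
open Summit.HodgeConjecture.HodgeConjecture.Cruxes.H413.K2E1CharacterEisensteinU2Defs
open Summit.HodgeConjecture.HodgeConjecture.Cruxes.H413.K2E1ChiSectionSpaceU2Defs
open Summit.HodgeConjecture.HodgeConjecture.Cruxes.H413.K2E1PlancherelIsometryOfForm (mem_topologicalClosure_span)
open Summit.HodgeConjecture.HodgeConjecture.Cruxes.H413.K2E1PlancherelModelMapOfIsometry (completeSpace_topologicalClosure_span modelMap_apply_of_mem modelMap_apply_eq_modelMap_proj)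
open Summit.HodgeConjecture.HodgeConjecture.Cruxes.H413.K2E1ChiSectionPlancherelGramDischargeCMTwo (exists_repr_and_linearIsometry_chiSection_offDual_letterFree_cm_two)
open Summit.HodgeConjecture.HodgeConjecture.Cruxes.H413.K2E1ChiSectionHeckeIntertwiningCMTwo (hU_offDual_cm_two)
open Summit.HodgeConjecture.HodgeConjecture.Cruxes.H413.K2E1ChiSectionHeckeIntertwiningGlobalCMTwo (hU_offDual_global_cm_two)
open Summit.HodgeConjecture.HodgeConjecture.Cruxes.H413.K2E1PseudoEisensteinSmoothBricksDenseU2 (topologicalClosure_span_continuous_eq_smooth)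
open Summit.HodgeConjecture.HodgeConjecture.Cruxes.H413.K2E1ChiSectionBoundedOfUnitaryU2 (exists_bound_of_isChiSection_of_isUnitary hχb_of_isUnitary)
open Summit.HodgeConjecture.HodgeConjecture.Cruxes.H413.K2E1ChiSectionSmoothingProfileU2 (contDiff_smoothingProfile hasCompactSupport_smoothingProfile tsupport_smoothingProfile_subset_Ioi)
open Summit.HodgeConjecture.HodgeConjecture.Cruxes.H413.K2E1SymbolLineNoMassCMTwo (hline_of_map_absolutelyContinuous)
open Summit.HodgeConjecture.HodgeConjecture.Cruxes.H413.K2E1SphericalEisensteinStructuralDataCMTwo (exists_unipotent_haar_fundamentalDomain_cm_two isInvInvariant_of_isHaarMeasure_cm_two)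
open Summit.HodgeConjecture.HodgeConjecture.Cruxes.H413.K2E1ResidualBlockPackageOffDualHeckeCMTwo
open Summit.HodgeConjecture.HodgeConjecture.Cruxes.H413.K2E1MaximalLevelHeckePureTensorBridgeCMTwo (adelicVal_archToAdelic_inclusion_mem_standardMaximalCompactGL)

namespace Summit.HodgeConjecture.HodgeConjecture.Cruxes.H413.K2E1ResidualBlockPackageOffDualFamilyCMTwo

variable (L : Type) [Field L] [NumberField L] [IsCMField L]
  (μ : Measure (quasiSplit (↥(maximalRealSubfield L)) L (IsCMField.complexConj L) 2).automorphicQuotient)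

/-! ## §0 Two lines of linear algebra for the `hU` clause (abstract modules; keeps the head's elaboration light) -/

section Abstract

variable {H M A S : Type*} [AddCommGroup H] [Module ℂ H] [AddCommGroup M] [Module ℂ M] [AddCommGroup A] [Module ℂ A] [HSMul S M M]

/-- `((0, U) ∘ P_G)(T v).2 = c • ((0, U) ∘ P_G)(v).2` from `T v = P_1 w`, `P_G P_1 = P_G`, `U P_G = U`, `U w = c • U v`. [folklore] -/
theorem snd_prod_comp_eq_smul (U : H →ₗ[ℂ] M) (PG : H →ₗ[ℂ] H) {P₁ : H → H} {w₁ w₂ v : H} (c : S)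
    (hT : w₁ = P₁ w₂) (hPG : ∀ w, PG (P₁ w) = PG w) (hUG : ∀ w, U (PG w) = U w) (hU : U w₂ = c • U v) :
    ((LinearMap.prod (0 : H →ₗ[ℂ] A) U ∘ₗ PG) w₁).2 = c • ((LinearMap.prod (0 : H →ₗ[ℂ] A) U ∘ₗ PG) v).2 := by
  change U (PG w₁) = c • U (PG v)
  rw [hT, hPG, hUG, hUG, hU]

/-- The degenerate case: `U = 0` forces both sides to vanish (`c • 0 = 0` supplied). [folklore] -/
theorem snd_prod_comp_eq_smul_of_zero (U : H →ₗ[ℂ] M) (PG : H →ₗ[ℂ] H) {w₁ v : H} (c : S) (hU0 : ∀ w, U w = 0) (hc0 : c • (0 : M) = 0) :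
    ((LinearMap.prod (0 : H →ₗ[ℂ] A) U ∘ₗ PG) w₁).2 = c • ((LinearMap.prod (0 : H →ₗ[ℂ] A) U ∘ₗ PG) v).2 := by
  change U (PG w₁) = c • U (PG v)
  rw [hU0, hU0, hc0]

end Abstract

/-! ## §1 The index family of an off-dual block and the identification of the C7 block with its closed span -/

/-- A class `x ∈ L²(X)` represented by `quotFun E((f∘H)·φ)` with `f ∈ C_c((0,∞))` and `φ ∈ V(χ, K_c, 1)` continuous IS a C⁰-brick (`x = hv.toLp _` for the transported `MemLp`).
[cite: MoeglinWaldspurger1995, II.1.2] -/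
theorem mem_bricks_of_ae_eq {χ : HeckeCharacter L} {Kc : Subgroup (quasiSplit (↥(maximalRealSubfield L)) L (IsCMField.complexConj L) 2).Adelic} {f : ℝ → ℂ} (hf : Continuous f) (hfs : HasCompactSupport f) (hf0 : tsupport f ⊆ Ioi 0)
    {φ : (quasiSplit (↥(maximalRealSubfield L)) L (IsCMField.complexConj L) 2).Adelic → ℂ} (hφ : φ ∈ chiSectionSpace χ Kc 1) (hφc : Continuous φ) {x : (quasiSplit (↥(maximalRealSubfield L)) L (IsCMField.complexConj L) 2).L2 μ}
    (hx : (x : (quasiSplit (↥(maximalRealSubfield L)) L (IsCMField.complexConj L) 2).automorphicQuotient → ℂ) =ᵐ[μ] (quasiSplit (↥(maximalRealSubfield L)) L (IsCMField.complexConj L) 2).quotFun (eisensteinSeriesU (fun g : (quasiSplit (↥(maximalRealSubfield L)) L (IsCMField.complexConj L) 2).Adelic => f (borelHeight g : ℝ) * φ g))) :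
    x ∈ {v : (quasiSplit (↥(maximalRealSubfield L)) L (IsCMField.complexConj L) 2).L2 μ |
        ∃ (f : ℝ → ℂ) (_ : Continuous f) (_ : HasCompactSupport f) (_ : tsupport f ⊆ Ioi 0)
          (φ : (quasiSplit (↥(maximalRealSubfield L)) L (IsCMField.complexConj L) 2).Adelic → ℂ) (_ : φ ∈ chiSectionSpace χ Kc 1) (_ : Continuous φ)
          (hv : MemLp ((quasiSplit (↥(maximalRealSubfield L)) L (IsCMField.complexConj L) 2).quotFun (eisensteinSeriesU (fun g => f (borelHeight g) * φ g))) 2 μ), v = hv.toLp _} := by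
  have hv : MemLp ((quasiSplit (↥(maximalRealSubfield L)) L (IsCMField.complexConj L) 2).quotFun (eisensteinSeriesU (fun g : (quasiSplit (↥(maximalRealSubfield L)) L (IsCMField.complexConj L) 2).Adelic => f (borelHeight g : ℝ) * φ g))) 2 μ := (Lp.memLp x).ae_eq hx
  refine ⟨f, hf, hfs, hf0, φ, hφ, hφc, hv, Lp.ext (hx.trans hv.coeFn_toLp.symm)⟩

/-- A `χ`-section vanishing at every point of `K` vanishes identically (adelic Iwasawa `G = B·K`, ★ `exists_mem_borelAdelic_mul_mem_standardMaximalCompactGL_cm`). [cite: BorelJacquet1979, §4.1] -/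
theorem eq_zero_of_isChiSection_of_forall_K {χ : HeckeCharacter L} {φ : (quasiSplit (↥(maximalRealSubfield L)) L (IsCMField.complexConj L) 2).Adelic → ℂ} (hφ : IsChiSection χ φ)
    (h0 : ∀ k : (quasiSplit (↥(maximalRealSubfield L)) L (IsCMField.complexConj L) 2).Adelic, adelicVal (↥(maximalRealSubfield L)) L (IsCMField.complexConj L) 2 ((StdForm.antidiagonal 2).over L) k ∈ standardMaximalCompactGL 2 L → φ k = 0) : φ = 0 := by
  funext g
  obtain ⟨b, hb, k, hk, rfl⟩ := exists_mem_borelAdelic_mul_mem_standardMaximalCompactGL_cm L (N := 2) g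
  rw [hφ b hb k, h0 k hk, mul_zero, Pi.zero_apply]

/-- The brick of the zero section is zero: `E((f∘H)·0) = 0`, `quotFun 0 = 0`. [folklore] -/
theorem toLp_brick_eq_zero_of_section_eq_zero {f : ℝ → ℂ} {φ : (quasiSplit (↥(maximalRealSubfield L)) L (IsCMField.complexConj L) 2).Adelic → ℂ} (hφ0 : φ = 0)
    (hv : MemLp ((quasiSplit (↥(maximalRealSubfield L)) L (IsCMField.complexConj L) 2).quotFun (eisensteinSeriesU (fun g : (quasiSplit (↥(maximalRealSubfield L)) L (IsCMField.complexConj L) 2).Adelic => f (borelHeight g : ℝ) * φ g))) 2 μ) : hv.toLp _ = 0 := by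
  subst hφ0
  have h0 : (fun g : (quasiSplit (↥(maximalRealSubfield L)) L (IsCMField.complexConj L) 2).Adelic => f (borelHeight g : ℝ) * (0 : (quasiSplit (↥(maximalRealSubfield L)) L (IsCMField.complexConj L) 2).Adelic → ℂ) g) = 0 := funext fun g => by simp
  have hE : eisensteinSeriesU (fun g : (quasiSplit (↥(maximalRealSubfield L)) L (IsCMField.complexConj L) 2).Adelic => f (borelHeight g : ℝ) * (0 : (quasiSplit (↥(maximalRealSubfield L)) L (IsCMField.complexConj L) 2).Adelic → ℂ) g) = 0 := by
    rw [h0]; funext g; exact eisensteinSeriesU_zero g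
  refine Lp.ext (hv.coeFn_toLp.trans ?_)
  rw [hE, AdelicGroupData.quotFun_zero]
  exact (Lp.coeFn_zero ℂ 2 μ).symm


variable [MeasurableSpace (quasiSplit (↥(maximalRealSubfield L)) L (IsCMField.complexConj L) 2).Adelic] [BorelSpace (quasiSplit (↥(maximalRealSubfield L)) L (IsCMField.complexConj L) 2).Adelic]

/-- **THE C7 BLOCK IS THE CLOSED SPAN OF THE OFF-DUAL FAMILY** (finding (BD), ruling (274)(ii)): for unitary `χ`, the closed span of the C⁰-profile bricks of level `K_c` EQUALS the closed span of
any family of `L²`-representatives `x_i =ᵐ quotFun E((f_i∘H)·φ_i)` indexed by ALL `C²_c((0,∞))`-profiles and continuous sections `φ ∈ V(χ, K_c, 1)` not vanishing on `K` — `⊇`: each `x_i` is a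
C⁰-brick; `⊆`: ★ `topologicalClosure_span_continuous_eq_smooth` (C⁰- and C^∞-profile bricks have the same closed span, `hχb` ★ `hχb_of_isUnitary`) and a C^∞-brick is an `x_i` or, if its section
vanishes on `K` (hence everywhere, Iwasawa), zero. [cite: MoeglinWaldspurger1995, II.1.2–II.1.3] [cite: Folland1999, Prop. 8.17] -/
theorem topologicalClosure_span_bricks_eq [IsFiniteMeasure μ] {χ : HeckeCharacter L} (hχu : χ.IsUnitary) {Kc : Subgroup (quasiSplit (↥(maximalRealSubfield L)) L (IsCMField.complexConj L) 2).Adelic}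
    {Idx : Set ((ℝ → ℂ) × ((quasiSplit (↥(maximalRealSubfield L)) L (IsCMField.complexConj L) 2).Adelic → ℂ))}
    (hI : Idx = {p : (ℝ → ℂ) × ((quasiSplit (↥(maximalRealSubfield L)) L (IsCMField.complexConj L) 2).Adelic → ℂ) | ContDiff ℝ 2 p.1 ∧ HasCompactSupport p.1 ∧ tsupport p.1 ⊆ Ioi 0 ∧ p.2 ∈ chiSectionSpace χ Kc 1 ∧ Continuous p.2 ∧
        ∃ k : (quasiSplit (↥(maximalRealSubfield L)) L (IsCMField.complexConj L) 2).Adelic, adelicVal (↥(maximalRealSubfield L)) L (IsCMField.complexConj L) 2 ((StdForm.antidiagonal 2).over L) k ∈ standardMaximalCompactGL 2 L ∧ p.2 k ≠ 0})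
    (x : ↥Idx → (quasiSplit (↥(maximalRealSubfield L)) L (IsCMField.complexConj L) 2).L2 μ)
    (hx : ∀ i : ↥Idx, (x i : (quasiSplit (↥(maximalRealSubfield L)) L (IsCMField.complexConj L) 2).automorphicQuotient → ℂ) =ᵐ[μ] (quasiSplit (↥(maximalRealSubfield L)) L (IsCMField.complexConj L) 2).quotFun (eisensteinSeriesU (fun g : (quasiSplit (↥(maximalRealSubfield L)) L (IsCMField.complexConj L) 2).Adelic => (i : (ℝ → ℂ) × ((quasiSplit (↥(maximalRealSubfield L)) L (IsCMField.complexConj L) 2).Adelic → ℂ)).1 (borelHeight g : ℝ) * (i : (ℝ → ℂ) × ((quasiSplit (↥(maximalRealSubfield L)) L (IsCMField.complexConj L) 2).Adelic → ℂ)).2 g))) :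
    (Submodule.span ℂ {v : (quasiSplit (↥(maximalRealSubfield L)) L (IsCMField.complexConj L) 2).L2 μ |
        ∃ (f : ℝ → ℂ) (_ : Continuous f) (_ : HasCompactSupport f) (_ : tsupport f ⊆ Ioi 0)
          (φ : (quasiSplit (↥(maximalRealSubfield L)) L (IsCMField.complexConj L) 2).Adelic → ℂ) (_ : φ ∈ chiSectionSpace χ Kc 1) (_ : Continuous φ)
          (hv : MemLp ((quasiSplit (↥(maximalRealSubfield L)) L (IsCMField.complexConj L) 2).quotFun (eisensteinSeriesU (fun g => f (borelHeight g) * φ g))) 2 μ), v = hv.toLp _}).topologicalClosure = (Submodule.span ℂ (Set.range x)).topologicalClosure := by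
  subst hI
  apply le_antisymm
  · -- `⊆`: through the smooth bricks
    rw [topologicalClosure_span_continuous_eq_smooth L μ χ Kc (hχb_of_isUnitary L hχu Kc)]
    refine Submodule.topologicalClosure_minimal _ (Submodule.span_le.2 ?_) (Submodule.isClosed_topologicalClosure _)
    rintro v ⟨f, hf, -, hfs, hf0, φ, hφ, hφc, hv, rfl⟩
    by_cases hK : ∃ k : (quasiSplit (↥(maximalRealSubfield L)) L (IsCMField.complexConj L) 2).Adelic, adelicVal (↥(maximalRealSubfield L)) L (IsCMField.complexConj L) 2 ((StdForm.antidiagonal 2).over L) k ∈ standardMaximalCompactGL 2 L ∧ φ k ≠ 0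
    · have hi : ((f, φ) : (ℝ → ℂ) × ((quasiSplit (↥(maximalRealSubfield L)) L (IsCMField.complexConj L) 2).Adelic → ℂ)) ∈ {p : (ℝ → ℂ) × ((quasiSplit (↥(maximalRealSubfield L)) L (IsCMField.complexConj L) 2).Adelic → ℂ) | ContDiff ℝ 2 p.1 ∧ HasCompactSupport p.1 ∧ tsupport p.1 ⊆ Ioi 0 ∧ p.2 ∈ chiSectionSpace χ Kc 1 ∧ Continuous p.2 ∧
        ∃ k : (quasiSplit (↥(maximalRealSubfield L)) L (IsCMField.complexConj L) 2).Adelic, adelicVal (↥(maximalRealSubfield L)) L (IsCMField.complexConj L) 2 ((StdForm.antidiagonal 2).over L) k ∈ standardMaximalCompactGL 2 L ∧ p.2 k ≠ 0} :=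
        ⟨hf.of_le (WithTop.coe_le_coe.2 le_top), hfs, hf0, hφ, hφc, hK⟩
      have hxv : x ⟨(f, φ), hi⟩ = hv.toLp _ := Lp.ext ((hx ⟨(f, φ), hi⟩).trans hv.coeFn_toLp.symm)
      rw [← hxv]
      exact Submodule.le_topologicalClosure _ (Submodule.subset_span (Set.mem_range_self _))
    · push Not at hK
      have hφ0 : φ = 0 := eq_zero_of_isChiSection_of_forall_K L ((mem_chiSectionSpace_iff φ).1 hφ).1 hK
      rw [toLp_brick_eq_zero_of_section_eq_zero L μ hφ0 hv]
      exact Submodule.zero_mem _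
  · -- `⊇`: each representative is a C⁰-brick
    refine Submodule.topologicalClosure_mono (Submodule.span_mono ?_)
    rintro _ ⟨i, rfl⟩
    obtain ⟨hf, hfs, hf0, hφ, hφc, -⟩ := i.2
    exact mem_bricks_of_ae_eq L μ hf.continuous hfs hf0 hφ hφc (hx i)

/-! ## §2 The all-of-`L²` intertwining `U R(η) = σ • U` for the off-dual family (★ (y2)) -/

section Intertwining

variable [(quasiSplit (↥(maximalRealSubfield L)) L (IsCMField.complexConj L) 2).IsAutomorphicMeasure μ]
  (νG : Measure (quasiSplit (↥(maximalRealSubfield L)) L (IsCMField.complexConj L) 2).Adelic) [νG.IsHaarMeasure] [νG.IsInvInvariant] [SFinite νG]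
  (μKU : Measure ((standardMaximalCompactGL 2 L).comap (adelicVal (↥(maximalRealSubfield L)) L (IsCMField.complexConj L) 2 ((StdForm.antidiagonal 2).over L)) : Subgroup (quasiSplit (↥(maximalRealSubfield L)) L (IsCMField.complexConj L) 2).Adelic)) [IsFiniteMeasure μKU]

omit [νG.IsInvInvariant] in
/-- **`R(η)Θ ⊆ Θ`** for the off-dual family of §1 (★ B2 `hU_offDual_cm_two`: the family is closed under the smoothing profile of `η`). [cite: MoeglinWaldspurger1995, II.2.4] -/
theorem integratedOperator_mem_closure_span_offDual [ENNReal.HolderTriple ∞ 2 2]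
    [LocallyCompactSpace (quasiSplit (↥(maximalRealSubfield L)) L (IsCMField.complexConj L) 2).Adelic] [SecondCountableTopology (quasiSplit (↥(maximalRealSubfield L)) L (IsCMField.complexConj L) 2).Adelic]
    (η : C_c((quasiSplit (↥(maximalRealSubfield L)) L (IsCMField.complexConj L) 2).Adelic, ℂ))
    {χ : HeckeCharacter L} (hχu : χ.IsUnitary) {Kc : Subgroup (quasiSplit (↥(maximalRealSubfield L)) L (IsCMField.complexConj L) 2).Adelic}
    {s : ℂ → ℂ} (hsd : Differentiable ℂ s)
    (hact : ∀ (z : ℂ), ∀ φ ∈ chiSectionSpace χ Kc 1, ∀ x : (quasiSplit (↥(maximalRealSubfield L)) L (IsCMField.complexConj L) 2).Adelic, (∫ y, η y * flatSectionU φ z (x * y) ∂νG) = s z * flatSectionU φ z x)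
    {Idx : Set ((ℝ → ℂ) × ((quasiSplit (↥(maximalRealSubfield L)) L (IsCMField.complexConj L) 2).Adelic → ℂ))}
    (hI : Idx = {p : (ℝ → ℂ) × ((quasiSplit (↥(maximalRealSubfield L)) L (IsCMField.complexConj L) 2).Adelic → ℂ) | ContDiff ℝ 2 p.1 ∧ HasCompactSupport p.1 ∧ tsupport p.1 ⊆ Ioi 0 ∧ p.2 ∈ chiSectionSpace χ Kc 1 ∧ Continuous p.2 ∧
        ∃ k : (quasiSplit (↥(maximalRealSubfield L)) L (IsCMField.complexConj L) 2).Adelic, adelicVal (↥(maximalRealSubfield L)) L (IsCMField.complexConj L) 2 ((StdForm.antidiagonal 2).over L) k ∈ standardMaximalCompactGL 2 L ∧ p.2 k ≠ 0}) [Nonempty ↥Idx]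
    (x : ↥Idx → (quasiSplit (↥(maximalRealSubfield L)) L (IsCMField.complexConj L) 2).L2 μ)
    (hx : ∀ i : ↥Idx, (x i : (quasiSplit (↥(maximalRealSubfield L)) L (IsCMField.complexConj L) 2).automorphicQuotient → ℂ) =ᵐ[μ] (quasiSplit (↥(maximalRealSubfield L)) L (IsCMField.complexConj L) 2).quotFun (eisensteinSeriesU (fun g : (quasiSplit (↥(maximalRealSubfield L)) L (IsCMField.complexConj L) 2).Adelic => (i : (ℝ → ℂ) × ((quasiSplit (↥(maximalRealSubfield L)) L (IsCMField.complexConj L) 2).Adelic → ℂ)).1 (borelHeight g : ℝ) * (i : (ℝ → ℂ) × ((quasiSplit (↥(maximalRealSubfield L)) L (IsCMField.complexConj L) 2).Adelic → ℂ)).2 g)))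
    (u : ↥Idx → Lp ℂ 2 ((volume : Measure ℝ).prod μKU))
    (hu : ∀ i : ↥Idx, (u i : ℝ × ((standardMaximalCompactGL 2 L).comap (adelicVal (↥(maximalRealSubfield L)) L (IsCMField.complexConj L) 2 ((StdForm.antidiagonal 2).over L)) : Subgroup (quasiSplit (↥(maximalRealSubfield L)) L (IsCMField.complexConj L) 2).Adelic) → ℂ) =ᵐ[(volume : Measure ℝ).prod μKU]
      fun p => mellin (i : (ℝ → ℂ) × ((quasiSplit (↥(maximalRealSubfield L)) L (IsCMField.complexConj L) 2).Adelic → ℂ)).1 (-((((1 / 2 : ℝ)) : ℂ) + p.1 * I)) * (i : (ℝ → ℂ) × ((quasiSplit (↥(maximalRealSubfield L)) L (IsCMField.complexConj L) 2).Adelic → ℂ)).2 (p.2 : (quasiSplit (↥(maximalRealSubfield L)) L (IsCMField.complexConj L) 2).Adelic))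
    {cU : ℂ} (U : (Submodule.span ℂ (Set.range x)).topologicalClosure →ₗᵢ[ℂ] Lp ℂ 2 ((volume : Measure ℝ).prod μKU))
    (hU : ∀ i, U ⟨x i, mem_topologicalClosure_span x i⟩ = cU • u i) :
    ∀ v ∈ (Submodule.span ℂ (Set.range x)).topologicalClosure, (((quasiSplit (↥(maximalRealSubfield L)) L (IsCMField.complexConj L) 2).rightRegular μ).integratedOperator ((quasiSplit (↥(maximalRealSubfield L)) L (IsCMField.complexConj L) 2).isUnitary_rightRegular μ) ((quasiSplit (↥(maximalRealSubfield L)) L (IsCMField.complexConj L) 2).isStronglyContinuous_rightRegular_holds μ) νG η) v ∈ (Submodule.span ℂ (Set.range x)).topologicalClosure := by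
  subst hI
  -- the family data in ★ (y2)'s currency
  have hIx := fun i : ↥{p : (ℝ → ℂ) × ((quasiSplit (↥(maximalRealSubfield L)) L (IsCMField.complexConj L) 2).Adelic → ℂ) | ContDiff ℝ 2 p.1 ∧ HasCompactSupport p.1 ∧ tsupport p.1 ⊆ Ioi 0 ∧ p.2 ∈ chiSectionSpace χ Kc 1 ∧ Continuous p.2 ∧
        ∃ k : (quasiSplit (↥(maximalRealSubfield L)) L (IsCMField.complexConj L) 2).Adelic, adelicVal (↥(maximalRealSubfield L)) L (IsCMField.complexConj L) 2 ((StdForm.antidiagonal 2).over L) k ∈ standardMaximalCompactGL 2 L ∧ p.2 k ≠ 0} => i.2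
  choose k₀ hk₀ hx₀ using fun i : ↥{p : (ℝ → ℂ) × ((quasiSplit (↥(maximalRealSubfield L)) L (IsCMField.complexConj L) 2).Adelic → ℂ) | ContDiff ℝ 2 p.1 ∧ HasCompactSupport p.1 ∧ tsupport p.1 ⊆ Ioi 0 ∧ p.2 ∈ chiSectionSpace χ Kc 1 ∧ Continuous p.2 ∧
        ∃ k : (quasiSplit (↥(maximalRealSubfield L)) L (IsCMField.complexConj L) 2).Adelic, adelicVal (↥(maximalRealSubfield L)) L (IsCMField.complexConj L) 2 ((StdForm.antidiagonal 2).over L) k ∈ standardMaximalCompactGL 2 L ∧ p.2 k ≠ 0} => i.2.2.2.2.2.2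
  choose Mφ hφM using fun i : ↥{p : (ℝ → ℂ) × ((quasiSplit (↥(maximalRealSubfield L)) L (IsCMField.complexConj L) 2).Adelic → ℂ) | ContDiff ℝ 2 p.1 ∧ HasCompactSupport p.1 ∧ tsupport p.1 ⊆ Ioi 0 ∧ p.2 ∈ chiSectionSpace χ Kc 1 ∧ Continuous p.2 ∧
        ∃ k : (quasiSplit (↥(maximalRealSubfield L)) L (IsCMField.complexConj L) 2).Adelic, adelicVal (↥(maximalRealSubfield L)) L (IsCMField.complexConj L) 2 ((StdForm.antidiagonal 2).over L) k ∈ standardMaximalCompactGL 2 L ∧ p.2 k ≠ 0} => exists_bound_of_isChiSection_of_isUnitary L 2 hχu ((mem_chiSectionSpace_iff _).1 i.2.2.2.2.1).1 i.2.2.2.2.2.1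
  have hφ : ∀ i : ↥{p : (ℝ → ℂ) × ((quasiSplit (↥(maximalRealSubfield L)) L (IsCMField.complexConj L) 2).Adelic → ℂ) | ContDiff ℝ 2 p.1 ∧ HasCompactSupport p.1 ∧ tsupport p.1 ⊆ Ioi 0 ∧ p.2 ∈ chiSectionSpace χ Kc 1 ∧ Continuous p.2 ∧
        ∃ k : (quasiSplit (↥(maximalRealSubfield L)) L (IsCMField.complexConj L) 2).Adelic, adelicVal (↥(maximalRealSubfield L)) L (IsCMField.complexConj L) 2 ((StdForm.antidiagonal 2).over L) k ∈ standardMaximalCompactGL 2 L ∧ p.2 k ≠ 0}, IsChiSection χ (i : (ℝ → ℂ) × ((quasiSplit (↥(maximalRealSubfield L)) L (IsCMField.complexConj L) 2).Adelic → ℂ)).2 := fun i => ((mem_chiSectionSpace_iff _).1 i.2.2.2.2.1).1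
  have hφc : ∀ i : ↥{p : (ℝ → ℂ) × ((quasiSplit (↥(maximalRealSubfield L)) L (IsCMField.complexConj L) 2).Adelic → ℂ) | ContDiff ℝ 2 p.1 ∧ HasCompactSupport p.1 ∧ tsupport p.1 ⊆ Ioi 0 ∧ p.2 ∈ chiSectionSpace χ Kc 1 ∧ Continuous p.2 ∧
        ∃ k : (quasiSplit (↥(maximalRealSubfield L)) L (IsCMField.complexConj L) 2).Adelic, adelicVal (↥(maximalRealSubfield L)) L (IsCMField.complexConj L) 2 ((StdForm.antidiagonal 2).over L) k ∈ standardMaximalCompactGL 2 L ∧ p.2 k ≠ 0}, Continuous (i : (ℝ → ℂ) × ((quasiSplit (↥(maximalRealSubfield L)) L (IsCMField.complexConj L) 2).Adelic → ℂ)).2 := fun i => i.2.2.2.2.2.1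
  have hf : ∀ i : ↥{p : (ℝ → ℂ) × ((quasiSplit (↥(maximalRealSubfield L)) L (IsCMField.complexConj L) 2).Adelic → ℂ) | ContDiff ℝ 2 p.1 ∧ HasCompactSupport p.1 ∧ tsupport p.1 ⊆ Ioi 0 ∧ p.2 ∈ chiSectionSpace χ Kc 1 ∧ Continuous p.2 ∧
        ∃ k : (quasiSplit (↥(maximalRealSubfield L)) L (IsCMField.complexConj L) 2).Adelic, adelicVal (↥(maximalRealSubfield L)) L (IsCMField.complexConj L) 2 ((StdForm.antidiagonal 2).over L) k ∈ standardMaximalCompactGL 2 L ∧ p.2 k ≠ 0}, ContDiff ℝ 2 (i : (ℝ → ℂ) × ((quasiSplit (↥(maximalRealSubfield L)) L (IsCMField.complexConj L) 2).Adelic → ℂ)).1 := fun i => i.2.1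
  have hfs : ∀ i : ↥{p : (ℝ → ℂ) × ((quasiSplit (↥(maximalRealSubfield L)) L (IsCMField.complexConj L) 2).Adelic → ℂ) | ContDiff ℝ 2 p.1 ∧ HasCompactSupport p.1 ∧ tsupport p.1 ⊆ Ioi 0 ∧ p.2 ∈ chiSectionSpace χ Kc 1 ∧ Continuous p.2 ∧
        ∃ k : (quasiSplit (↥(maximalRealSubfield L)) L (IsCMField.complexConj L) 2).Adelic, adelicVal (↥(maximalRealSubfield L)) L (IsCMField.complexConj L) 2 ((StdForm.antidiagonal 2).over L) k ∈ standardMaximalCompactGL 2 L ∧ p.2 k ≠ 0}, HasCompactSupport (i : (ℝ → ℂ) × ((quasiSplit (↥(maximalRealSubfield L)) L (IsCMField.complexConj L) 2).Adelic → ℂ)).1 := fun i => i.2.2.1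
  have hf0 : ∀ i : ↥{p : (ℝ → ℂ) × ((quasiSplit (↥(maximalRealSubfield L)) L (IsCMField.complexConj L) 2).Adelic → ℂ) | ContDiff ℝ 2 p.1 ∧ HasCompactSupport p.1 ∧ tsupport p.1 ⊆ Ioi 0 ∧ p.2 ∈ chiSectionSpace χ Kc 1 ∧ Continuous p.2 ∧
        ∃ k : (quasiSplit (↥(maximalRealSubfield L)) L (IsCMField.complexConj L) 2).Adelic, adelicVal (↥(maximalRealSubfield L)) L (IsCMField.complexConj L) 2 ((StdForm.antidiagonal 2).over L) k ∈ standardMaximalCompactGL 2 L ∧ p.2 k ≠ 0}, tsupport (i : (ℝ → ℂ) × ((quasiSplit (↥(maximalRealSubfield L)) L (IsCMField.complexConj L) 2).Adelic → ℂ)).1 ⊆ Ioi 0 := fun i => i.2.2.2.1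
  have hact' : ∀ (i : ↥{p : (ℝ → ℂ) × ((quasiSplit (↥(maximalRealSubfield L)) L (IsCMField.complexConj L) 2).Adelic → ℂ) | ContDiff ℝ 2 p.1 ∧ HasCompactSupport p.1 ∧ tsupport p.1 ⊆ Ioi 0 ∧ p.2 ∈ chiSectionSpace χ Kc 1 ∧ Continuous p.2 ∧
        ∃ k : (quasiSplit (↥(maximalRealSubfield L)) L (IsCMField.complexConj L) 2).Adelic, adelicVal (↥(maximalRealSubfield L)) L (IsCMField.complexConj L) 2 ((StdForm.antidiagonal 2).over L) k ∈ standardMaximalCompactGL 2 L ∧ p.2 k ≠ 0}) (z : ℂ) (y : (quasiSplit (↥(maximalRealSubfield L)) L (IsCMField.complexConj L) 2).Adelic), ∫ w, η w * flatSectionU (i : (ℝ → ℂ) × ((quasiSplit (↥(maximalRealSubfield L)) L (IsCMField.complexConj L) 2).Adelic → ℂ)).2 z (y * w) ∂νG = s z * flatSectionU (i : (ℝ → ℂ) × ((quasiSplit (↥(maximalRealSubfield L)) L (IsCMField.complexConj L) 2).Adelic → ℂ)).2 z y :=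
    fun i z y => hact z _ i.2.2.2.2.1 y
  -- the family is closed under the smoothing profile of `η`
  have hτmem : ∀ i : ↥{p : (ℝ → ℂ) × ((quasiSplit (↥(maximalRealSubfield L)) L (IsCMField.complexConj L) 2).Adelic → ℂ) | ContDiff ℝ 2 p.1 ∧ HasCompactSupport p.1 ∧ tsupport p.1 ⊆ Ioi 0 ∧ p.2 ∈ chiSectionSpace χ Kc 1 ∧ Continuous p.2 ∧
        ∃ k : (quasiSplit (↥(maximalRealSubfield L)) L (IsCMField.complexConj L) 2).Adelic, adelicVal (↥(maximalRealSubfield L)) L (IsCMField.complexConj L) 2 ((StdForm.antidiagonal 2).over L) k ∈ standardMaximalCompactGL 2 L ∧ p.2 k ≠ 0}, ((fun r : ℝ => ∫ w, (i : (ℝ → ℂ) × ((quasiSplit (↥(maximalRealSubfield L)) L (IsCMField.complexConj L) 2).Adelic → ℂ)).1 (r * (borelHeight w : ℝ)) * (η ((k₀ i)⁻¹ * w) * ((i : (ℝ → ℂ) × ((quasiSplit (↥(maximalRealSubfield L)) L (IsCMField.complexConj L) 2).Adelic → ℂ)).2 w / (i : (ℝ → ℂ) × ((quasiSplit (↥(maximalRealSubfield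 L)) L (IsCMField.complexConj L) 2).Adelic → ℂ)).2 (k₀ i))) ∂νG),
      (i : (ℝ → ℂ) × ((quasiSplit (↥(maximalRealSubfield L)) L (IsCMField.complexConj L) 2).Adelic → ℂ)).2) ∈ {p : (ℝ → ℂ) × ((quasiSplit (↥(maximalRealSubfield L)) L (IsCMField.complexConj L) 2).Adelic → ℂ) | ContDiff ℝ 2 p.1 ∧ HasCompactSupport p.1 ∧ tsupport p.1 ⊆ Ioi 0 ∧ p.2 ∈ chiSectionSpace χ Kc 1 ∧ Continuous p.2 ∧
        ∃ k : (quasiSplit (↥(maximalRealSubfield L)) L (IsCMField.complexConj L) 2).Adelic, adelicVal (↥(maximalRealSubfield L)) L (IsCMField.complexConj L) 2 ((StdForm.antidiagonal 2).over L) k ∈ standardMaximalCompactGL 2 L ∧ p.2 k ≠ 0} := fun i =>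
    ⟨contDiff_smoothingProfile νG η.continuous η.hasCompactSupport (hφc i) (k₀ i) (hf i) (hfs i),
      hasCompactSupport_smoothingProfile νG η.hasCompactSupport _ (k₀ i) (hfs i) (hf0 i),
      tsupport_smoothingProfile_subset_Ioi νG η.hasCompactSupport _ (k₀ i) (hfs i) (hf0 i), i.2.2.2.2.1, hφc i, k₀ i, hk₀ i, hx₀ i⟩
  set τ : ↥{p : (ℝ → ℂ) × ((quasiSplit (↥(maximalRealSubfield L)) L (IsCMField.complexConj L) 2).Adelic → ℂ) | ContDiff ℝ 2 p.1 ∧ HasCompactSupport p.1 ∧ tsupport p.1 ⊆ Ioi 0 ∧ p.2 ∈ chiSectionSpace χ Kc 1 ∧ Continuous p.2 ∧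
        ∃ k : (quasiSplit (↥(maximalRealSubfield L)) L (IsCMField.complexConj L) 2).Adelic, adelicVal (↥(maximalRealSubfield L)) L (IsCMField.complexConj L) 2 ((StdForm.antidiagonal 2).over L) k ∈ standardMaximalCompactGL 2 L ∧ p.2 k ≠ 0} → ↥{p : (ℝ → ℂ) × ((quasiSplit (↥(maximalRealSubfield L)) L (IsCMField.complexConj L) 2).Adelic → ℂ) | ContDiff ℝ 2 p.1 ∧ HasCompactSupport p.1 ∧ tsupport p.1 ⊆ Ioi 0 ∧ p.2 ∈ chiSectionSpace χ Kc 1 ∧ Continuous p.2 ∧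
        ∃ k : (quasiSplit (↥(maximalRealSubfield L)) L (IsCMField.complexConj L) 2).Adelic, adelicVal (↥(maximalRealSubfield L)) L (IsCMField.complexConj L) 2 ((StdForm.antidiagonal 2).over L) k ∈ standardMaximalCompactGL 2 L ∧ p.2 k ≠ 0} := fun i => ⟨_, hτmem i⟩ with hτ
  obtain ⟨hw₀, hB2⟩ := hU_offDual_cm_two L μ νG μKU η hφ hφc Mφ hφM k₀ hk₀ hx₀ hf hfs hf0 hsd.continuous hact' x hx u hu τ (fun i => hx (τ i)) (fun i => hu (τ i)) U hU
  exact fun v hv => (hB2 v hv).1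

set_option maxHeartbeats 400000 in
/-- **`U(R(η)v) = σ • U v` FOR EVERY `v ∈ L²(X)`** on the off-dual family of §1 (★ (y2) `hU_offDual_global_cm_two`): the family indexed by ALL `(f, φ)` with `f ∈ C²_c((0,∞))`, `φ ∈ V(χ, K_c, 1)`
continuous and non-zero on `K` is CLOSED under the smoothing profile of `η` (★ `contDiff_smoothingProfile` ∕ `hasCompactSupport_smoothingProfile` ∕ `tsupport_smoothingProfile_subset_Ioi`), its
sections are bounded (★ `exists_bound_of_isChiSection_of_isUnitary`), and `R(η)† = R(η)` for the real symmetric `η` (★ `adjoint_integratedOperator`) maps `Θ` into `Θ` (★ B2) — so the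
letter `hadjΘ` of ★ (y2) is discharged. [cite: MoeglinWaldspurger1995, II.2.4, VI.2] [cite: ReedSimonI1980, Thm. II.3] -/
theorem exists_modelMap_intertwining [ENNReal.HolderTriple ∞ 2 2]
    [LocallyCompactSpace (quasiSplit (↥(maximalRealSubfield L)) L (IsCMField.complexConj L) 2).Adelic] [SecondCountableTopology (quasiSplit (↥(maximalRealSubfield L)) L (IsCMField.complexConj L) 2).Adelic]
    (η : C_c((quasiSplit (↥(maximalRealSubfield L)) L (IsCMField.complexConj L) 2).Adelic, ℂ)) (hηsymm : ∀ g, η g⁻¹ = η g) (hηreal : ∀ g, conj (η g) = η g)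
    {χ : HeckeCharacter L} (hχu : χ.IsUnitary) {Kc : Subgroup (quasiSplit (↥(maximalRealSubfield L)) L (IsCMField.complexConj L) 2).Adelic}
    {s : ℂ → ℂ} (hsd : Differentiable ℂ s)
    (hact : ∀ (z : ℂ), ∀ φ ∈ chiSectionSpace χ Kc 1, ∀ x : (quasiSplit (↥(maximalRealSubfield L)) L (IsCMField.complexConj L) 2).Adelic, (∫ y, η y * flatSectionU φ z (x * y) ∂νG) = s z * flatSectionU φ z x)
    {Idx : Set ((ℝ → ℂ) × ((quasiSplit (↥(maximalRealSubfield L)) L (IsCMField.complexConj L) 2).Adelic → ℂ))}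
    (hI : Idx = {p : (ℝ → ℂ) × ((quasiSplit (↥(maximalRealSubfield L)) L (IsCMField.complexConj L) 2).Adelic → ℂ) | ContDiff ℝ 2 p.1 ∧ HasCompactSupport p.1 ∧ tsupport p.1 ⊆ Ioi 0 ∧ p.2 ∈ chiSectionSpace χ Kc 1 ∧ Continuous p.2 ∧
        ∃ k : (quasiSplit (↥(maximalRealSubfield L)) L (IsCMField.complexConj L) 2).Adelic, adelicVal (↥(maximalRealSubfield L)) L (IsCMField.complexConj L) 2 ((StdForm.antidiagonal 2).over L) k ∈ standardMaximalCompactGL 2 L ∧ p.2 k ≠ 0}) [Nonempty ↥Idx]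
    (x : ↥Idx → (quasiSplit (↥(maximalRealSubfield L)) L (IsCMField.complexConj L) 2).L2 μ)
    (hx : ∀ i : ↥Idx, (x i : (quasiSplit (↥(maximalRealSubfield L)) L (IsCMField.complexConj L) 2).automorphicQuotient → ℂ) =ᵐ[μ] (quasiSplit (↥(maximalRealSubfield L)) L (IsCMField.complexConj L) 2).quotFun (eisensteinSeriesU (fun g : (quasiSplit (↥(maximalRealSubfield L)) L (IsCMField.complexConj L) 2).Adelic => (i : (ℝ → ℂ) × ((quasiSplit (↥(maximalRealSubfield L)) L (IsCMField.complexConj L) 2).Adelic → ℂ)).1 (borelHeight g : ℝ) * (i : (ℝ → ℂ) × ((quasiSplit (↥(maximalRealSubfield L)) L (IsCMField.complexConj L) 2).Adelic → ℂ)).2 g)))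
    (u : ↥Idx → Lp ℂ 2 ((volume : Measure ℝ).prod μKU))
    (hu : ∀ i : ↥Idx, (u i : ℝ × ((standardMaximalCompactGL 2 L).comap (adelicVal (↥(maximalRealSubfield L)) L (IsCMField.complexConj L) 2 ((StdForm.antidiagonal 2).over L)) : Subgroup (quasiSplit (↥(maximalRealSubfield L)) L (IsCMField.complexConj L) 2).Adelic) → ℂ) =ᵐ[(volume : Measure ℝ).prod μKU]
      fun p => mellin (i : (ℝ → ℂ) × ((quasiSplit (↥(maximalRealSubfield L)) L (IsCMField.complexConj L) 2).Adelic → ℂ)).1 (-((((1 / 2 : ℝ)) : ℂ) + p.1 * I)) * (i : (ℝ → ℂ) × ((quasiSplit (↥(maximalRealSubfield L)) L (IsCMField.complexConj L) 2).Adelic → ℂ)).2 (p.2 : (quasiSplit (↥(maximalRealSubfield L)) L (IsCMField.complexConj L) 2).Adelic))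
    {cU : ℂ} (U : (Submodule.span ℂ (Set.range x)).topologicalClosure →ₗᵢ[ℂ] Lp ℂ 2 ((volume : Measure ℝ).prod μKU))
    (hU : ∀ i, U ⟨x i, mem_topologicalClosure_span x i⟩ = cU • u i) :
    ∃ hw : MemLp (fun p : ℝ × ((standardMaximalCompactGL 2 L).comap (adelicVal (↥(maximalRealSubfield L)) L (IsCMField.complexConj L) 2 ((StdForm.antidiagonal 2).over L)) : Subgroup (quasiSplit (↥(maximalRealSubfield L)) L (IsCMField.complexConj L) 2).Adelic) => s ((((1 / 2 : ℝ)) : ℂ) + p.1 * Complex.I)) ∞ ((volume : Measure ℝ).prod μKU),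
      ∀ v : (quasiSplit (↥(maximalRealSubfield L)) L (IsCMField.complexConj L) 2).L2 μ,
        haveI := completeSpace_topologicalClosure_span x
        (U.toContinuousLinearMap.comp (Submodule.span ℂ (Set.range x)).topologicalClosure.orthogonalProjectionOnto) ((((quasiSplit (↥(maximalRealSubfield L)) L (IsCMField.complexConj L) 2).rightRegular μ).integratedOperator ((quasiSplit (↥(maximalRealSubfield L)) L (IsCMField.complexConj L) 2).isUnitary_rightRegular μ) ((quasiSplit (↥(maximalRealSubfield L)) L (IsCMField.complexConj L) 2).isStronglyContinuous_rightRegular_holds μ) νG η) v) = (hw.toLp _ : Lp ℂ ∞ ((volume : Measure ℝ).prod μKU)) • (U.toContinuousLinearMap.comp (Submodule.span ℂ (Set.range x)).topologicalClosure.orthogonalProjectionOnto) v := by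
  subst hI
  -- the family data in ★ (y2)'s currency
  have hIx := fun i : ↥{p : (ℝ → ℂ) × ((quasiSplit (↥(maximalRealSubfield L)) L (IsCMField.complexConj L) 2).Adelic → ℂ) | ContDiff ℝ 2 p.1 ∧ HasCompactSupport p.1 ∧ tsupport p.1 ⊆ Ioi 0 ∧ p.2 ∈ chiSectionSpace χ Kc 1 ∧ Continuous p.2 ∧
        ∃ k : (quasiSplit (↥(maximalRealSubfield L)) L (IsCMField.complexConj L) 2).Adelic, adelicVal (↥(maximalRealSubfield L)) L (IsCMField.complexConj L) 2 ((StdForm.antidiagonal 2).over L) k ∈ standardMaximalCompactGL 2 L ∧ p.2 k ≠ 0} => i.2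
  choose k₀ hk₀ hx₀ using fun i : ↥{p : (ℝ → ℂ) × ((quasiSplit (↥(maximalRealSubfield L)) L (IsCMField.complexConj L) 2).Adelic → ℂ) | ContDiff ℝ 2 p.1 ∧ HasCompactSupport p.1 ∧ tsupport p.1 ⊆ Ioi 0 ∧ p.2 ∈ chiSectionSpace χ Kc 1 ∧ Continuous p.2 ∧
        ∃ k : (quasiSplit (↥(maximalRealSubfield L)) L (IsCMField.complexConj L) 2).Adelic, adelicVal (↥(maximalRealSubfield L)) L (IsCMField.complexConj L) 2 ((StdForm.antidiagonal 2).over L) k ∈ standardMaximalCompactGL 2 L ∧ p.2 k ≠ 0} => i.2.2.2.2.2.2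
  choose Mφ hφM using fun i : ↥{p : (ℝ → ℂ) × ((quasiSplit (↥(maximalRealSubfield L)) L (IsCMField.complexConj L) 2).Adelic → ℂ) | ContDiff ℝ 2 p.1 ∧ HasCompactSupport p.1 ∧ tsupport p.1 ⊆ Ioi 0 ∧ p.2 ∈ chiSectionSpace χ Kc 1 ∧ Continuous p.2 ∧
        ∃ k : (quasiSplit (↥(maximalRealSubfield L)) L (IsCMField.complexConj L) 2).Adelic, adelicVal (↥(maximalRealSubfield L)) L (IsCMField.complexConj L) 2 ((StdForm.antidiagonal 2).over L) k ∈ standardMaximalCompactGL 2 L ∧ p.2 k ≠ 0} => exists_bound_of_isChiSection_of_isUnitary L 2 hχu ((mem_chiSectionSpace_iff _).1 i.2.2.2.2.1).1 i.2.2.2.2.2.1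
  have hφ : ∀ i : ↥{p : (ℝ → ℂ) × ((quasiSplit (↥(maximalRealSubfield L)) L (IsCMField.complexConj L) 2).Adelic → ℂ) | ContDiff ℝ 2 p.1 ∧ HasCompactSupport p.1 ∧ tsupport p.1 ⊆ Ioi 0 ∧ p.2 ∈ chiSectionSpace χ Kc 1 ∧ Continuous p.2 ∧
        ∃ k : (quasiSplit (↥(maximalRealSubfield L)) L (IsCMField.complexConj L) 2).Adelic, adelicVal (↥(maximalRealSubfield L)) L (IsCMField.complexConj L) 2 ((StdForm.antidiagonal 2).over L) k ∈ standardMaximalCompactGL 2 L ∧ p.2 k ≠ 0}, IsChiSection χ (i : (ℝ → ℂ) × ((quasiSplit (↥(maximalRealSubfield L)) L (IsCMField.complexConj L) 2).Adelic → ℂ)).2 := fun i => ((mem_chiSectionSpace_iff _).1 i.2.2.2.2.1).1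
  have hφc : ∀ i : ↥{p : (ℝ → ℂ) × ((quasiSplit (↥(maximalRealSubfield L)) L (IsCMField.complexConj L) 2).Adelic → ℂ) | ContDiff ℝ 2 p.1 ∧ HasCompactSupport p.1 ∧ tsupport p.1 ⊆ Ioi 0 ∧ p.2 ∈ chiSectionSpace χ Kc 1 ∧ Continuous p.2 ∧
        ∃ k : (quasiSplit (↥(maximalRealSubfield L)) L (IsCMField.complexConj L) 2).Adelic, adelicVal (↥(maximalRealSubfield L)) L (IsCMField.complexConj L) 2 ((StdForm.antidiagonal 2).over L) k ∈ standardMaximalCompactGL 2 L ∧ p.2 k ≠ 0}, Continuous (i : (ℝ → ℂ) × ((quasiSplit (↥(maximalRealSubfield L)) L (IsCMField.complexConj L) 2).Adelic → ℂ)).2 := fun i => i.2.2.2.2.2.1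
  have hf : ∀ i : ↥{p : (ℝ → ℂ) × ((quasiSplit (↥(maximalRealSubfield L)) L (IsCMField.complexConj L) 2).Adelic → ℂ) | ContDiff ℝ 2 p.1 ∧ HasCompactSupport p.1 ∧ tsupport p.1 ⊆ Ioi 0 ∧ p.2 ∈ chiSectionSpace χ Kc 1 ∧ Continuous p.2 ∧
        ∃ k : (quasiSplit (↥(maximalRealSubfield L)) L (IsCMField.complexConj L) 2).Adelic, adelicVal (↥(maximalRealSubfield L)) L (IsCMField.complexConj L) 2 ((StdForm.antidiagonal 2).over L) k ∈ standardMaximalCompactGL 2 L ∧ p.2 k ≠ 0}, ContDiff ℝ 2 (i : (ℝ → ℂ) × ((quasiSplit (↥(maximalRealSubfield L)) L (IsCMField.complexConj L) 2).Adelic → ℂ)).1 := fun i => i.2.1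
  have hfs : ∀ i : ↥{p : (ℝ → ℂ) × ((quasiSplit (↥(maximalRealSubfield L)) L (IsCMField.complexConj L) 2).Adelic → ℂ) | ContDiff ℝ 2 p.1 ∧ HasCompactSupport p.1 ∧ tsupport p.1 ⊆ Ioi 0 ∧ p.2 ∈ chiSectionSpace χ Kc 1 ∧ Continuous p.2 ∧
        ∃ k : (quasiSplit (↥(maximalRealSubfield L)) L (IsCMField.complexConj L) 2).Adelic, adelicVal (↥(maximalRealSubfield L)) L (IsCMField.complexConj L) 2 ((StdForm.antidiagonal 2).over L) k ∈ standardMaximalCompactGL 2 L ∧ p.2 k ≠ 0}, HasCompactSupport (i : (ℝ → ℂ) × ((quasiSplit (↥(maximalRealSubfield L)) L (IsCMField.complexConj L) 2).Adelic → ℂ)).1 := fun i => i.2.2.1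
  have hf0 : ∀ i : ↥{p : (ℝ → ℂ) × ((quasiSplit (↥(maximalRealSubfield L)) L (IsCMField.complexConj L) 2).Adelic → ℂ) | ContDiff ℝ 2 p.1 ∧ HasCompactSupport p.1 ∧ tsupport p.1 ⊆ Ioi 0 ∧ p.2 ∈ chiSectionSpace χ Kc 1 ∧ Continuous p.2 ∧
        ∃ k : (quasiSplit (↥(maximalRealSubfield L)) L (IsCMField.complexConj L) 2).Adelic, adelicVal (↥(maximalRealSubfield L)) L (IsCMField.complexConj L) 2 ((StdForm.antidiagonal 2).over L) k ∈ standardMaximalCompactGL 2 L ∧ p.2 k ≠ 0}, tsupport (i : (ℝ → ℂ) × ((quasiSplit (↥(maximalRealSubfield L)) L (IsCMField.complexConj L) 2).Adelic → ℂ)).1 ⊆ Ioi 0 := fun i => i.2.2.2.1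
  have hact' : ∀ (i : ↥{p : (ℝ → ℂ) × ((quasiSplit (↥(maximalRealSubfield L)) L (IsCMField.complexConj L) 2).Adelic → ℂ) | ContDiff ℝ 2 p.1 ∧ HasCompactSupport p.1 ∧ tsupport p.1 ⊆ Ioi 0 ∧ p.2 ∈ chiSectionSpace χ Kc 1 ∧ Continuous p.2 ∧
        ∃ k : (quasiSplit (↥(maximalRealSubfield L)) L (IsCMField.complexConj L) 2).Adelic, adelicVal (↥(maximalRealSubfield L)) L (IsCMField.complexConj L) 2 ((StdForm.antidiagonal 2).over L) k ∈ standardMaximalCompactGL 2 L ∧ p.2 k ≠ 0}) (z : ℂ) (y : (quasiSplit (↥(maximalRealSubfield L)) L (IsCMField.complexConj L) 2).Adelic), ∫ w, η w * flatSectionU (i : (ℝ → ℂ) × ((quasiSplit (↥(maximalRealSubfield L)) L (IsCMField.complexConj L) 2).Adelic → ℂ)).2 z (y * w) ∂νG = s z * flatSectionU (i : (ℝ → ℂ) × ((quasiSplit (↥(maximalRealSubfield L)) L (IsCMField.complexConj L) 2).Adelic → ℂ)).2 z y :=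
    fun i z y => hact z _ i.2.2.2.2.1 y
  -- the family is closed under the smoothing profile of `η`
  have hτmem : ∀ i : ↥{p : (ℝ → ℂ) × ((quasiSplit (↥(maximalRealSubfield L)) L (IsCMField.complexConj L) 2).Adelic → ℂ) | ContDiff ℝ 2 p.1 ∧ HasCompactSupport p.1 ∧ tsupport p.1 ⊆ Ioi 0 ∧ p.2 ∈ chiSectionSpace χ Kc 1 ∧ Continuous p.2 ∧
        ∃ k : (quasiSplit (↥(maximalRealSubfield L)) L (IsCMField.complexConj L) 2).Adelic, adelicVal (↥(maximalRealSubfield L)) L (IsCMField.complexConj L) 2 ((StdForm.antidiagonal 2).over L) k ∈ standardMaximalCompactGL 2 L ∧ p.2 k ≠ 0}, ((fun r : ℝ => ∫ w, (i : (ℝ → ℂ) × ((quasiSplit (↥(maximalRealSubfield L)) L (IsCMField.complexConj L) 2).Adelic → ℂ)).1 (r * (borelHeight w : ℝ)) * (η ((k₀ i)⁻¹ * w) * ((i : (ℝ → ℂ) × ((quasiSplit (↥(maximalRealSubfield L)) L (IsCMField.complexConj L) 2).Adelic → ℂ)).2 w / (i : (ℝ → ℂ) × ((quasiSplit (↥(maximalRealSubfield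 L)) L (IsCMField.complexConj L) 2).Adelic → ℂ)).2 (k₀ i))) ∂νG),
      (i : (ℝ → ℂ) × ((quasiSplit (↥(maximalRealSubfield L)) L (IsCMField.complexConj L) 2).Adelic → ℂ)).2) ∈ {p : (ℝ → ℂ) × ((quasiSplit (↥(maximalRealSubfield L)) L (IsCMField.complexConj L) 2).Adelic → ℂ) | ContDiff ℝ 2 p.1 ∧ HasCompactSupport p.1 ∧ tsupport p.1 ⊆ Ioi 0 ∧ p.2 ∈ chiSectionSpace χ Kc 1 ∧ Continuous p.2 ∧
        ∃ k : (quasiSplit (↥(maximalRealSubfield L)) L (IsCMField.complexConj L) 2).Adelic, adelicVal (↥(maximalRealSubfield L)) L (IsCMField.complexConj L) 2 ((StdForm.antidiagonal 2).over L) k ∈ standardMaximalCompactGL 2 L ∧ p.2 k ≠ 0} := fun i =>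
    ⟨contDiff_smoothingProfile νG η.continuous η.hasCompactSupport (hφc i) (k₀ i) (hf i) (hfs i),
      hasCompactSupport_smoothingProfile νG η.hasCompactSupport _ (k₀ i) (hfs i) (hf0 i),
      tsupport_smoothingProfile_subset_Ioi νG η.hasCompactSupport _ (k₀ i) (hfs i) (hf0 i), i.2.2.2.2.1, hφc i, k₀ i, hk₀ i, hx₀ i⟩
  set τ : ↥{p : (ℝ → ℂ) × ((quasiSplit (↥(maximalRealSubfield L)) L (IsCMField.complexConj L) 2).Adelic → ℂ) | ContDiff ℝ 2 p.1 ∧ HasCompactSupport p.1 ∧ tsupport p.1 ⊆ Ioi 0 ∧ p.2 ∈ chiSectionSpace χ Kc 1 ∧ Continuous p.2 ∧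
        ∃ k : (quasiSplit (↥(maximalRealSubfield L)) L (IsCMField.complexConj L) 2).Adelic, adelicVal (↥(maximalRealSubfield L)) L (IsCMField.complexConj L) 2 ((StdForm.antidiagonal 2).over L) k ∈ standardMaximalCompactGL 2 L ∧ p.2 k ≠ 0} → ↥{p : (ℝ → ℂ) × ((quasiSplit (↥(maximalRealSubfield L)) L (IsCMField.complexConj L) 2).Adelic → ℂ) | ContDiff ℝ 2 p.1 ∧ HasCompactSupport p.1 ∧ tsupport p.1 ⊆ Ioi 0 ∧ p.2 ∈ chiSectionSpace χ Kc 1 ∧ Continuous p.2 ∧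
        ∃ k : (quasiSplit (↥(maximalRealSubfield L)) L (IsCMField.complexConj L) 2).Adelic, adelicVal (↥(maximalRealSubfield L)) L (IsCMField.complexConj L) 2 ((StdForm.antidiagonal 2).over L) k ∈ standardMaximalCompactGL 2 L ∧ p.2 k ≠ 0} := fun i => ⟨_, hτmem i⟩ with hτ
  -- `R(η)† = R(η)` (real symmetric `η`) and `R(η)Θ ⊆ Θ` ⇒ `hadjΘ`
  have hadj : ContinuousLinearMap.adjoint (((quasiSplit (↥(maximalRealSubfield L)) L (IsCMField.complexConj L) 2).rightRegular μ).integratedOperator ((quasiSplit (↥(maximalRealSubfield L)) L (IsCMField.complexConj L) 2).isUnitary_rightRegular μ) ((quasiSplit (↥(maximalRealSubfield L)) L (IsCMField.complexConj L) 2).isStronglyContinuous_rightRegular_holds μ) νG η) = (((quasiSplit (↥(maximalRealSubfield L)) L (IsCMField.complexConj L) 2).rightRegular μ).integratedOperator ((quasiSplit (↥(maximalRealSubfield L)) L (IsCMField.complexConj L) 2).isUnitary_rightRegular μ) ((quasiSplit (↥(maximalRealSubfield L)) L (IsCMField.complexConj L) 2).isStronglyContinuous_rightRegular_holds μ) νG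 η) :=
    ContRepresentation.adjoint_integratedOperator ((quasiSplit (↥(maximalRealSubfield L)) L (IsCMField.complexConj L) 2).isUnitary_rightRegular μ) ((quasiSplit (↥(maximalRealSubfield L)) L (IsCMField.complexConj L) 2).isStronglyContinuous_rightRegular_holds μ) νG η η fun g => by rw [mulStar, hηsymm, hηreal]
  have hstab := integratedOperator_mem_closure_span_offDual L μ νG μKU η hχu hsd hact rfl x hx u hu U hU
  have hadjΘ : ∀ v ∈ (Submodule.span ℂ (Set.range x)).topologicalClosure, ContinuousLinearMap.adjoint (((quasiSplit (↥(maximalRealSubfield L)) L (IsCMField.complexConj L) 2).rightRegular μ).integratedOperator ((quasiSplit (↥(maximalRealSubfield L)) L (IsCMField.complexConj L) 2).isUnitary_rightRegular μ) ((quasiSplit (↥(maximalRealSubfield L)) L (IsCMField.complexConj L) 2).isStronglyContinuous_rightRegular_holds μ) νG η) v ∈ (Submodule.span ℂ (Set.range x)).topologicalClosure :=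
    fun v hv => by rw [hadj]; exact hstab v hv
  exact hU_offDual_global_cm_two L μ νG μKU η hφ hφc Mφ hφM k₀ hk₀ hx₀ hf hfs hf0 hsd.continuous hact' x hx u hu τ (fun i => hx (τ i)) (fun i => hu (τ i)) U hU hadjΘ

end Intertwining

/-! ## §3 Two small model lemmas: the line coordinate is Lebesgue-absolutely-continuous; a bounded symbol for the degenerate block -/

section ModelLine

variable {X : Type*} [MeasurableSpace X] (mX : Measure X)

/-- The first coordinate of `ℝ × K_U` pushes `volume ⊗ μ_K` forward to `μ_K(K_U) • volume ≪ volume` (Mathlib `Measure.map_fst_prod`). [folklore] -/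
theorem map_fst_prod_absolutelyContinuous [SFinite mX] : ((volume : Measure ℝ).prod mX).map Prod.fst ≪ (volume : Measure ℝ) := by
  rw [Measure.map_fst_prod]
  exact Measure.smul_absolutelyContinuous

/-- **`hline` ON THE MODEL `ℝ × K_U` FROM ONE ENTIRE NON-CONSTANT SYMBOL READ ON THE AXIS** (★ `hline_of_map_absolutelyContinuous`, `ℓ = Prod.fst`, `t₀ = 0`), in the axis spelling
`s(((1/2 : ℝ) : ℂ) + y·I)` of ★ (y2). [cite: ReedSimonI1980, §VII.2] [cite: MoeglinWaldspurger1995, IV.3.12] -/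
theorem hline_model [SFinite mX] {s : ℂ → ℂ} (hsd : Differentiable ℂ s) (hnc : ∃ z₁ z₂ : ℂ, s z₁ ≠ s z₂) :
    ∀ c : Unit → ℂ, ((volume : Measure ℝ).prod mX) {p : ℝ × X | ∀ j : Unit, (fun (_ : Unit) (q : ℝ × X) => s ((((1 / 2 : ℝ)) : ℂ) + q.1 * Complex.I)) j p = c j} = 0 := by
  intro c
  have h := hline_of_map_absolutelyContinuous ((volume : Measure ℝ).prod mX) measurable_fst (map_fst_prod_absolutelyContinuous mX) (fun _ : Unit => s) () hsd hnc 0 Set.univ c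
  rw [Set.univ_inter] at h
  have hset : {p : ℝ × X | ∀ j : Unit, (fun (_ : Unit) (q : ℝ × X) => s ((((1 / 2 : ℝ)) : ℂ) + q.1 * Complex.I)) j p = c j} =
      {p : ℝ × X | ∀ j : Unit, (fun _ : Unit => s) j ((1 / 2 : ℂ) + ((p.1 + 0 : ℝ) : ℂ) * Complex.I) = c j} := by
    ext p
    simp only [Set.mem_setOf_eq, add_zero]
    have e : ((((1 / 2 : ℝ)) : ℂ) + (p.1 : ℂ) * Complex.I) = (1 / 2 : ℂ) + (p.1 : ℂ) * Complex.I := by push_cast; ring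
    rw [e]
  rw [hset]
  exact h

/-- A bounded entire non-constant symbol for the degenerate (trivial) block: `s(z) = sin(i(z − ½))`, `s(½ + iy) = −sin y`. [folklore] -/
theorem exists_bounded_entire_nonconstant [SFinite mX] :
    ∃ s : ℂ → ℂ, Differentiable ℂ s ∧ (∃ z₁ z₂ : ℂ, s z₁ ≠ s z₂) ∧ MemLp (fun q : ℝ × X => s ((((1 / 2 : ℝ)) : ℂ) + q.1 * Complex.I)) ∞ ((volume : Measure ℝ).prod mX) := by
  have key : ∀ y : ℝ, Complex.sin (Complex.I * (((((1 / 2 : ℝ)) : ℂ) + (y : ℂ) * Complex.I) - 1 / 2)) = -((Real.sin y : ℝ) : ℂ) := fun y => by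
    have e : Complex.I * (((((1 / 2 : ℝ)) : ℂ) + (y : ℂ) * Complex.I) - 1 / 2) = -(y : ℂ) := by
      push_cast; ring_nf; rw [Complex.I_sq]; ring
    rw [e, Complex.sin_neg, Complex.ofReal_sin]
  refine ⟨fun z => Complex.sin (Complex.I * (z - 1 / 2)), ?_, ⟨(((1 / 2 : ℝ)) : ℂ) + ((0 : ℝ) : ℂ) * Complex.I, (((1 / 2 : ℝ)) : ℂ) + ((Real.pi / 2 : ℝ) : ℂ) * Complex.I, ?_⟩, ?_⟩
  · exact Complex.differentiable_sin.comp ((differentiable_id.sub_const _).const_mul _)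
  · change Complex.sin (Complex.I * ((((1 / 2 : ℝ) : ℂ) + ((0 : ℝ) : ℂ) * Complex.I) - 1 / 2)) ≠ Complex.sin (Complex.I * ((((1 / 2 : ℝ) : ℂ) + ((Real.pi / 2 : ℝ) : ℂ) * Complex.I) - 1 / 2))
    rw [key, key, Real.sin_zero, Real.sin_pi_div_two]
    norm_num
  · have hfun : (fun q : ℝ × X => (fun z => Complex.sin (Complex.I * (z - 1 / 2))) ((((1 / 2 : ℝ)) : ℂ) + q.1 * Complex.I)) = fun q => -((Real.sin q.1 : ℝ) : ℂ) :=
      funext fun q => key q.1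
    rw [hfun]
    refine memLp_top_of_bound ((Complex.measurable_ofReal.comp (Real.measurable_sin.comp measurable_fst)).neg.aestronglyMeasurable) 1 (Filter.Eventually.of_forall fun q => ?_)
    rw [norm_neg, Complex.norm_real, Real.norm_eq_abs]
    exact Real.abs_sin_le_one _

end ModelLine

end Summit.HodgeConjecture.HodgeConjecture.Cruxes.H413.K2E1ResidualBlockPackageOffDualFamilyCMTwo

end
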